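import Summits.QuantumAdvantage.QuantumAdvantage.Theses.ParityFrontier
import Literature.Computability.Complexity.BPExpOperator
import Literature.Computability.Complexity.TodaPartOne
import Literature.Computability.Complexity.SipserGacsLautemann
import Literature.Computability.Complexity.NPClosureProofs
import Literature.Computability.Complexity.OracleEmpty
import Literature.Computability.Complexity.CircuitClasses
import Literature.Computability.Complexity.Promise
import Literature.Computability.QuantumComplexity.FactoringNP
import Literature.Computability.QuantumComplexity.BQPSubsetPP
import Literature.Computability.QuantumComplexity.BQPSubsetAWPP
import Literature.Computability.QuantumComplexity.CountingSimulationProofs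
import Literature.Computability.QuantumComplexity.OracleSeparationsProofs
import Literature.Computability.Cryptography.ClassBQPRelProofs

/-!
# STRATEGY CENSUS (typed companion) — crux `ParityFrontier.Target` (stmt-QuantumAdvantage-1952)

Unit `cstrat-stmt-QuantumAdvantage-1952-r1` (crux-strategist, RESTATED deciding crux, BC2-redirect audit).
`X := Target = ¬ (BQP ⊆ bp ParityP)` ("BQP ⊄ BP·⊕P"), `S := QuantumAdvantage = ∃ L ∈ BQP, L ∉ BPP`.
Question put to this seat: is there a typed decomposition `X₁ ∧ … ∧ X_k → X` (k ≥ 2) with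
(a) every piece load-bearing, (b) the assembly PROVED (a trivial seam is fine), (c) no piece giving `S`
or `X` on its own, (d) every OPEN piece planned (registered skeleton / live line)?

This file kernel-checks, sorry-free over LANDED modules only:
* §0 the crux and the summit by name; `X → S` (the route's `closes`).
* §1 the laws of two-piece decompositions (pure logic), as in the sibling census
  `Summits/PneNP/PneNP/Cruxes/CircuitThesis/StrategyCensus.lean`.
* §2 the NECESSARY CONSEQUENCES of `X` that are themselves open (`BQP ⊄ ⊕P`, `PP ⊄ BP·⊕P`,
  `AWPP ⊄ BP·⊕P`, `BQP ⊄ PH`, the promise form, the relativized frontier at `A = ∅`) — the only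
  admissible "first pieces" the tree offers — and, for each, that the pair {piece, piece → X} is
  literally `X` again (`pair_iff_X`).
* §3 TODA CLOSES THE CONDITIONAL-BRIDGE DOOR: every language of `PH` is in `BP·⊕P`
  (`PH_subset_bp_ParityP`, proved in the tree), so no `PH` problem — in particular not `FACT`
  (Shor's witness, `FACT ∈ NP ∩ coNP` proved in the tree) — can witness `X`; a Shor-type bridge
  "`FACT ∉ BP·⊕P`" is PROVABLY FALSE.
* §4 the candidate decompositions D1–D7 of the census: pieces as `def`s, their (trivial) assemblies,
  and the converse implications that place each piece relative to `X` and `S`; plus the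
  (c)-failure `¬ (BQP ⊆ PH) → S` (Sipser–Gács–Lautemann, landed).
Nothing here is a new conjecture; every `def … : Prop` is a census object, not a filed item.
-/

set_option linter.dupNamespace false
set_option autoImplicit false

namespace Summit.QuantumAdvantage.QuantumAdvantage.Cruxes.Target.StrategyCensus

open Literature.Computability.Complexity Literature.Computability.Cryptography
open Literature.Computability.QuantumComplexity
open Summit.QuantumAdvantage.QuantumAdvantage.Theses.ParityFrontier (Target RelFrontier closes)

/-! ## §0 The crux and the summit -/

abbrev X : Prop := Target

theorem X_def : X ↔ ¬ (BQP ⊆ bp ParityP) := Iff.rfl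

theorem S_def : _root_.QuantumAdvantage ↔ ∃ L : Language Bool, L ∈ BQP ∧ L ∉ BPP := Iff.rfl

/-- `X → S`: the route's deciding theorem (ParityFrontier.lean, `closes`). -/
theorem S_of_X (h : X) : _root_.QuantumAdvantage := closes h

/-- Witness form of `X`. -/
theorem X_iff_witness : X ↔ ∃ L : Language Bool, L ∈ BQP ∧ L ∉ bp ParityP := by
  constructor
  · intro h
    by_contra hne
    exact h fun L hL => by
      by_contra hLn
      exact hne ⟨L, hL, hLn⟩
  · rintro ⟨L, hL, hLn⟩ hsub
    exact hLn (hsub hL)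

/-! ## §1 Laws of two-piece decompositions `F₁ ∧ F₂ → X` (pure logic) -/

/-- LAW 0 (normal form): a two-piece assembly says exactly that the second piece carries `F₁ → X`. -/
theorem law0_normal_form (F₁ F₂ : Prop) : (F₁ ∧ F₂ → X) ↔ (F₂ → (F₁ → X)) :=
  ⟨fun h h₂ h₁ => h ⟨h₁, h₂⟩, fun h hp => h hp.2 hp.1⟩

/-- LAW A (summit leakage): if one piece holds in every `¬ S` world, its partner alone decides `S`
(criterion (c) fails for the partner). -/
theorem lawA_summit_leakage {F₁ F₂ : Prop} (h₁ : ¬ _root_.QuantumAdvantage → F₁) (hasm : F₁ ∧ F₂ → X) :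
    F₂ → _root_.QuantumAdvantage := by
  intro h₂
  by_contra hS
  exact hS (S_of_X (hasm ⟨h₁ hS, h₂⟩))

/-- LAW B (theorem leakage): a piece that already gives `X` makes every partner idle ((a) fails). -/
theorem lawB_theorem_leakage {F₁ : Prop} (h : F₁ → X) (F₂ : Prop) : F₁ ∧ F₂ → X := fun hp => h hp.1

/-- LAW D (the weakest partner is the seam): for a first piece `F` that `X` implies, the pair
`{F, F → X}` is exactly as strong as `X`; the partner `F → X` is `X ∨ ¬ F`. -/
theorem seam (F : Prop) : F ∧ (F → X) → X := fun hp => hp.2 hp.1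

theorem partner_is_X_or_not (F : Prop) : (F → X) ↔ (X ∨ ¬ F) := by
  constructor
  · intro h
    by_cases hF : F
    · exact Or.inl (h hF)
    · exact Or.inr hF
  · rintro (hX | hnF) hF
    · exact hX
    · exact (hnF hF).elim

theorem pair_iff_X (F : Prop) (hF : X → F) : (F ∧ (F → X)) ↔ X :=
  ⟨seam F, fun hX => ⟨hF hX, fun _ => hX⟩⟩

/-! ## §2 Necessary consequences of `X` that are open statements -/

/-- `⊕P ⊆ BP·⊕P` (no coins; `⊕P` is closed under Karp reductions). -/
theorem ParityP_subset_bp_ParityP : ParityP ⊆ bp ParityP :=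
  Set.Subset.trans (BPExp.subset_bpExp fun _ hL _ hf => ParityClosure.preimage_mem_ParityP hL hf)
    (bpExp_subset_bp ParityP)

/-- `BPP ⊆ BP·⊕P` (the inclusion behind `closes`). -/
theorem BPP_subset_bp_ParityP : BPP ⊆ bp ParityP := bp_mono ParityClosure.P_subset_ParityP

/-- C1. `X → BQP ⊄ ⊕P`. -/
theorem not_BQP_subset_ParityP_of_X (h : X) : ¬ (BQP ⊆ ParityP) :=
  fun hsub => h (Set.Subset.trans hsub ParityP_subset_bp_ParityP)

/-- C2. `X → PP ⊄ BP·⊕P` — "there is no Toda theorem for `PP`" (via `BQP ⊆ PP`, Adleman–DeMarrais–Huang, landed). -/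
theorem not_PP_subset_of_X (h : X) : ¬ (PP ⊆ bp ParityP) :=
  fun hsub => h (Set.Subset.trans BQP_subset_PP_holds hsub)

/-- C3. `X → AWPP ⊄ BP·⊕P` — "there is no Toda theorem for GapP gaps" (via `BQP ⊆ AWPP`, Fortnow–Rogers, landed). -/
theorem not_AWPP_subset_of_X (h : X) : ¬ (AWPP ⊆ bp ParityP) :=
  fun hsub => h (Set.Subset.trans BQP_subset_AWPP_holds hsub)

/-- C4. `X → BQP ⊄ PH` (via Toda part 1, landed; this is the route's support `TargetGivesBQPnotPH`). -/
theorem not_BQP_subset_PH_of_X (h : X) : ¬ (BQP ⊆ PH) :=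
  fun hsub => h (Set.Subset.trans hsub PH_subset_bp_ParityP)

/-- C5. `X → RelFrontier`: the unrelativized world is the instance `A = ∅` of the relativized
frontier (`BQPRel 0 = BQP`, `PRel ∅ = P`, both landed). So crux 1954 is a CONSEQUENCE of the target. -/
theorem relFrontier_of_X (h : X) : RelFrontier := by
  refine ⟨0, ?_⟩
  have hZ : BQPRel 0 = BQP := BQPRel_zero_holds
  have hE : PRel (Oracle.ofLanguage 0) = Classes.P := PRel_empty_holds
  rw [hZ, hE]
  exact h

/-! ## §3 Toda closes the conditional-bridge door -/

/-- Every `PH` language is in `BP·⊕P`; hence NO language of `PH` can witness `X`. -/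
theorem no_PH_witness {L : Language Bool} (hL : L ∈ PH) : ¬ (L ∈ BQP ∧ L ∉ bp ParityP) :=
  fun h => h.2 (PH_subset_bp_ParityP hL)

/-- A witness of `X` lies outside `PH` (and outside `⊕P`, and outside `BPP`). -/
theorem witness_outside_PH {L : Language Bool} (hL : L ∉ bp ParityP) : L ∉ PH ∧ L ∉ ParityP ∧ L ∉ BPP :=
  ⟨fun h => hL (PH_subset_bp_ParityP h), fun h => hL (ParityP_subset_bp_ParityP h),
    fun h => hL (BPP_subset_bp_ParityP h)⟩

/-- Shor's witness cannot serve: `FACT ∈ NP ⊆ PH ⊆ BP·⊕P` (all three landed). The Shor-type bridge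
hypothesis "`FACT ∉ BP·⊕P`" is therefore REFUTED in the tree. -/
theorem FACT_mem_bp_ParityP : FACT ∈ bp ParityP :=
  PH_subset_bp_ParityP (NP_subset_PH_holds FACT_mem_NP)

theorem shor_bridge_hypothesis_false : ¬ (FACT ∉ bp ParityP) := fun h => h FACT_mem_bp_ParityP

/-- More generally every `NP ∩ coNP` (indeed every `NP`) hardness hypothesis of the form `Q ∉ BP·⊕P` is false. -/
theorem NP_hardness_hypothesis_false {Q : Language Bool} (hQ : Q ∈ Nondeterministic.NP) : ¬ (Q ∉ bp ParityP) :=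
  fun h => h (PH_subset_bp_ParityP (NP_subset_PH_holds hQ))

/-! ## §4 The candidate decompositions (pieces, trivial assemblies, placement) -/

/-! ### D3a — derandomization split: `X ⇐ (BP·⊕P ⊆ ⊕P) ∧ (BQP ⊄ ⊕P)` -/

/-- Piece: derandomization of Schöning's `BP·` over `⊕P` (open; follows from `E ⊄ io-SIZE^{⊕P}(2^{εn})`
by Nisan–Wigderson/Klivans–van Melkebeek; implies `PH ⊆ ⊕P`). -/
def DerandBPParity : Prop := bp ParityP ⊆ ParityP

/-- Piece: `BQP ⊄ ⊕P` (open; a strict-looking consequence of `X`, C1). -/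
def BQPNotParityP : Prop := ¬ (BQP ⊆ ParityP)

theorem X_of_D3a (h₁ : DerandBPParity) (h₂ : BQPNotParityP) : X :=
  fun hX => h₂ fun _ hL => h₁ (hX hL)

theorem D3a_second_of_X (h : X) : BQPNotParityP := not_BQP_subset_ParityP_of_X h

/-! ### D3b — non-uniform split: `X ⇐ (BP·⊕P ⊆ ⊕P/poly) ∧ (BQP ⊄ ⊕P/poly)` -/

/-- Piece: Adleman's argument for `BP·⊕P` (provable: amplification inside `⊕P`, which is closed under
polynomial-time truth-table reductions, then hard-wire a good coin string). Not yet in the tree. -/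
def BPParitySubsetParityPoly : Prop := bp ParityP ⊆ polyAdvice ParityP

/-- Piece: `BQP ⊄ ⊕P/poly` — a circuit lower bound for a `BQP` function against `⊕P`-oracle circuits
(open; STRONGER than `X` given the previous piece). -/
def BQPNotParityPoly : Prop := ¬ (BQP ⊆ polyAdvice ParityP)

theorem X_of_D3b (h₁ : BPParitySubsetParityPoly) (h₂ : BQPNotParityPoly) : X :=
  fun hX => h₂ fun _ hL => h₁ (hX hL)

/-! ### D4 — the relativized bridge: `X ⇐ RelFrontier ∧ (RelFrontier → X)` -/

/-- Piece: "the relativized parity frontier transfers to the real world". -/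
def RelTransfer : Prop := RelFrontier → X

theorem X_of_D4 (h₁ : RelFrontier) (h₂ : RelTransfer) : X := h₂ h₁

theorem relTransfer_of_X (h : X) : RelTransfer := fun _ => h

/-- LAW D instance: the pair {RelFrontier, RelTransfer} is EXACTLY `X` (both are consequences of `X`). -/
theorem D4_pair_iff_X : (RelFrontier ∧ RelTransfer) ↔ X := pair_iff_X RelFrontier relFrontier_of_X

/-- … and the bridge piece is `X ∨ ¬ RelFrontier`. -/
theorem relTransfer_iff : RelTransfer ↔ (X ∨ ¬ RelFrontier) := partner_is_X_or_not RelFrontier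

/-! ### D5 — the promise split: `X ⇐ PromiseTarget ∧ ParityPromiseLift` -/

/-- Textbook promise-`BP·⊕P`: a `⊕P` predicate with a `2/3` gap ON THE PROMISE only (the `⊕P`
analogue of the tree's `PromiseBPP'`). -/
def PromiseBPParity' : Set PromiseProblem :=
  {Q | ∃ L' ∈ ParityP, ∃ p : Polynomial ℕ,
    (∀ x ∈ Q.yes, 2 / 3 ≤ uniformProb (p.eval x.length) {y : List Bool | boolPair x y ∈ L'}) ∧
    (∀ x ∈ Q.no, 2 / 3 ≤ uniformProb (p.eval x.length) {y : List Bool | boolPair x y ∉ L'})}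

/-- Piece: the promise separation `PromiseBQP ⊄ Promise-BP·⊕P` (it has complete problems:
explicit poly-fold FORRELATION, Aaronson–Ambainis 2015 Thm 5; QSim, ibid. Lemma 24). -/
def PromiseTarget : Prop := ¬ (PromiseBQP ⊆ PromiseBPParity')

/-- Piece: the parity promise lift (the `BP·⊕P` analogue of `PlLift`, stmt-0250). -/
def ParityPromiseLift : Prop := BQP ⊆ bp ParityP → PromiseBQP ⊆ PromiseBPParity'

theorem X_of_D5 (h₁ : PromiseTarget) (h₂ : ParityPromiseLift) : X := fun hX => h₁ (h₂ hX)

theorem parityPromiseLift_of_X (h : X) : ParityPromiseLift := fun hX => (h hX).elim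

/-- A language with trivial promise in `Promise-BP·⊕P'` is in `BP·⊕P`. -/
theorem mem_bp_ParityP_of_ofLanguage {L : Language Bool}
    (h : PromiseProblem.ofLanguage L ∈ PromiseBPParity') : L ∈ bp ParityP := by
  obtain ⟨L', hL', p, hyes, hno⟩ := h
  refine ⟨L', hL', p, fun x => ?_⟩
  by_cases hx : x ∈ L
  · have hset : {y : List Bool | boolPair x y ∈ L' ↔ x ∈ L} = {y : List Bool | boolPair x y ∈ L'} := by
      ext y; simp [hx]
    rw [hset]
    exact hyes x (by simpa using hx)
  · have hset : {y : List Bool | boolPair x y ∈ L' ↔ x ∈ L} = {y : List Bool | boolPair x y ∉ L'} := by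
      ext y; simp [hx]
    rw [hset]
    exact hno x hx

theorem promiseTarget_of_X (h : X) : PromiseTarget := by
  intro hsub
  apply h
  intro L hL
  exact mem_bp_ParityP_of_ofLanguage (hsub (ofLanguage_mem_PromiseBQP_iff.2 hL))

/-- The promise split is an EQUIVALENCE: `X ↔ PromiseTarget ∧ ParityPromiseLift`. -/
theorem X_iff_D5 : X ↔ PromiseTarget ∧ ParityPromiseLift :=
  ⟨fun h => ⟨promiseTarget_of_X h, parityPromiseLift_of_X h⟩, fun h => X_of_D5 h.1 h.2⟩

/-! ### D6 — weakest-unknown-consequence bridges: `X ⇐ C ∧ (C → X)` for `C ∈ {PP ⊄ BP·⊕P, AWPP ⊄ BP·⊕P, BQP ⊄ ⊕P, BQP ⊄ PH}` -/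

def PPNotBPParity : Prop := ¬ (PP ⊆ bp ParityP)
def AWPPNotBPParity : Prop := ¬ (AWPP ⊆ bp ParityP)
def BQPNotPH : Prop := ¬ (BQP ⊆ PH)

/-- The propagation piece "a `BP·⊕P` simulation of `BQP` extends to `PP`". -/
def PPBridge : Prop := PPNotBPParity → X

theorem X_of_D6 (h₁ : PPNotBPParity) (h₂ : PPBridge) : X := h₂ h₁

theorem D6_pair_iff_X : (PPNotBPParity ∧ PPBridge) ↔ X := pair_iff_X PPNotBPParity not_PP_subset_of_X

theorem ppBridge_iff : PPBridge ↔ (BQP ⊆ bp ParityP → PP ⊆ bp ParityP) := by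
  constructor
  · intro h hB
    by_contra hPP
    exact h hPP hB
  · intro h hPP hB
    exact hPP (h hB)

/-- (c)-FAILURE for the choice `C = BQP ⊄ PH`: that piece gives the SUMMIT on its own, by the landed
Sipser–Gács–Lautemann theorem `BPP ⊆ Σ₂ᵖ ⊆ PH`. -/
theorem summit_of_BQPNotPH (h : BQPNotPH) : _root_.QuantumAdvantage := by
  by_contra hS
  apply h
  intro L hL
  have hBPP : L ∈ BPP := by
    by_contra hnot
    exact hS ⟨L, hL, hnot⟩
  exact SigmaP_subset_PH 2 (BPP_subset_SigmaP_two hBPP)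

/-! ### D7 — the PH-collapse bridge: `X ⇐ (PH ⊄ BPP) ∧ (BQP ⊆ BP·⊕P → PH ⊆ BPP)` -/

def PHNotBPP : Prop := ¬ (PH ⊆ BPP)
def CollapseBridge : Prop := BQP ⊆ bp ParityP → PH ⊆ BPP

theorem X_of_D7 (h₁ : PHNotBPP) (h₂ : CollapseBridge) : X := fun hX => h₁ (h₂ hX)

theorem collapseBridge_of_X (h : X) : CollapseBridge := fun hX => (h hX).elim

/-! ### D1/D2 — witness and lower-sandwich splits: `X ⇐ (L₀ ∈ BQP) ∧ (L₀ ∉ BP·⊕P)`, `X ⇐ (D ⊆ BQP) ∧ (D ⊄ BP·⊕P)` -/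

theorem X_of_witness {L₀ : Language Bool} (h₁ : L₀ ∈ BQP) (h₂ : L₀ ∉ bp ParityP) : X :=
  X_iff_witness.2 ⟨L₀, h₁, h₂⟩

theorem X_of_sandwich {D : Set (Language Bool)} (h₁ : D ⊆ BQP) (h₂ : ¬ (D ⊆ bp ParityP)) : X :=
  fun hX => h₂ (Set.Subset.trans h₁ hX)

/-- … and by §3 the witness / the class `D` must avoid `PH` entirely. -/
theorem sandwich_avoids_PH {D : Set (Language Bool)} (h₂ : ¬ (D ⊆ bp ParityP)) : ¬ (D ⊆ PH) :=
  fun hD => h₂ (Set.Subset.trans hD PH_subset_bp_ParityP)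

/-! ### Barrier anchor (A01): the target's shape is relativized-FALSE at the collapsing oracle -/

/-- At Ko's / the `PSPACE`-complete oracle, `BQP^A ⊆ BPP^A` (landed), and `BPP^A = bp P^A ⊆ bp ⊕·P^A`
by `bp_mono`; so every piece of every split above that fails there needs a non-relativizing proof. -/
theorem collapsing_oracle : ∃ A : Language Bool, BQPRel A ⊆ BPPRel (Oracle.ofLanguage A) :=
  exists_oracle_BQPRel_subset_BPPRel_holds

end Summit.QuantumAdvantage.QuantumAdvantage.Cruxes.Target.StrategyCensus
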